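import Summits.BirchSwinnertonDyer.BirchSwinnertonDyer.Theorems.InertBadSignedBranchesInertBadAtThreeOffIstarZeroQuarticFamilyIff
import Summits.BirchSwinnertonDyer.BirchSwinnertonDyer.Theorems.InertBadSignedBranchesInertBadAtThreeIstarZeroOddSupply
import Literature.NumberTheory.EllipticCurves.QuadraticTwistJInvariantProofs
import HarnessLib

/-!
# Route `InertBadSignedBranches` (rung K8), D71 child `InertBadAtThreeOffIstarZero` (stmt-BirchSwinnertonDyer-19657,
# HELD residual): the TYPED OBSTRUCTION — no quadratic twist of a corner curve is good at `3`; the corner is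
# stable under every quadratic twist (`III ↔ III*` under odd `ord₃ d`); the good twin is QUARTIC
# (helper `--supports` 19657; cell `bsd-cm`, seat `bsd-cm-k8i-c42` g4; theorems only, nothing asserted)

HONEST FRAMING (cell `bsd-cm`, run/shared/lean/pub/bsd-cm/): Birch–Swinnerton-Dyer is NOT proved by any of
this. Item 19657 (`InertBadAtThreeOffIstarZero`) is HELD (planner D71/D91) — an open problem in print (seat
memos g0/g2/g3; literature pass g4: not found). THIS FILE does not attack it. It KERNEL-CHECKS the sentence
of the item's docstring that says WHY the route's lever cannot reach the corner — «no QUADRATIC twist with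
good reduction at 3 exists (only the quartic twist by 27 is good there)» — in the exact currency of the
lever: the O10 consumer `X12.O10.bsdp_of_hasSignedLocalType_IstarZero_of_valuation_of_readings` (p402929)
runs through `X12.O10.pairData_elim`, whose first output is a TWIN `V` with
`C • W.quadraticTwist ((-1) ^ (p / 2) * p) = V ∧ V.HasGoodReductionAtPrime p` (at `p = 3` the sibling
child 19656's `InertBadOdd.exists_goodTwist_pStar_of_hasSignedLocalType_IstarZero_of_ne_two`).

WHAT THIS FILE PROVES (UNCONDITIONAL, any rank, no data, no facts):
* §1 `smul_quadraticTwist_eq_quartic` — `D • W = (y² = x³ + a x)`, `C • W^{(d)} = V` ⟹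
  `(⟨D.u, d·D.r, 0, 0⟩ * C⁻¹) • V = (y² = x³ + d² a x)` (tree `quadraticTwist_smul` + `E_a^{(d)} = E_{d²a}`).
* §2 membership with a RATIONAL coefficient (`ord₃ a = s ∈ {1, 2, 3}` ⟹ signed type `III / I₀* / III*`)
  and the `3`-adic rescaling `(3ᵏ; 0, 0, 0)` into the window `ord₃ ∈ {1, 3}` when `ord₃ a` is odd.
* §3 **`hasSignedLocalType_three_of_smul_quadraticTwist`** — type `(3, III)` or `(3, III*)`, ANY `d`, ANY
  elliptic model `V` of `W^{(d)}`: `V` has type `(3, III)` or `(3, III*)` — the SAME one when `ord₃ d` is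
  even (`…_of_even`), the OTHER one when odd (`…_of_odd`; the route's own `p* = −3` SWAPS the halves
  `48 ↔ 49` of O10-SC@3, `…_swap_of_smul_quadraticTwist_pStar`); hence
  **`not_hasGoodReductionAtPrime_three_of_smul_quadraticTwist`** and `offIstarZero_of_smul_quadraticTwist`
  (the item's four hypotheses pass to every quadratic twist).
* §4 **`not_exists_good_quadraticTwist_of_offIstarZero`** — on 19657's corner there is NO `d : ℚ`, NO
  elliptic `V`, NO `C` with `C • W.quadraticTwist d = V ∧ V.HasGoodReductionAtPrime 3`: the lever's
  `pairData` does not exist there, for ANY quadratic character. With the sibling's supply: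
  **`hasSignedLocalType_IstarZero_iff_exists_good_quadraticTwist`** — on the inert-bad CM locus at `3`
  the D71 split `InertBadAtThree = IstarZero ⊔ OffIstarZero` IS the split «a good quadratic twin exists /
  does not exist».
* §5 what DOES exist: `W ≅ (y² = x³ + 3a x)` or `(y² = x³ + 27a x)`, `3 ∤ a`, and every curve
  `ℚ`-isomorphic to `y² = x³ + a x`, `3 ∤ a`, is GOOD at `3`, CM by `ℤ[i]`, `3` inert, `a₃ = 0` — the
  QUARTIC twin (`E_{3a} ≅ E_a` over `ℚ(∜3)`, `e = 4 = w_K` prime to `3`): the object a tame-branch signed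
  theory at `3` would be built on (cell node [B]; LTYZ 2025 method (I) at `(e, p) = (4, 3)`, memo g3 §3).

PARTITION (D-0054): CornerF inert-bad (B12 / O10) × O10-SC@3 = signed types `(3, III)` (48 census classes)
⊔ `(3, III*)` (49) = `{y² = x³ + Ax : ord₃ A odd}` × `p = 3` — types-the-object-of (the obstruction to the
route's lever, kernel-checked; the corner's symmetry under quadratic twists); closes no cell, no item;
moves no label; 19657 stays HELD. NOT in this file: no lower half, no class statement, no typed input, no
Literature statement, no named fact, no definition; the residual is not restated weaker or stronger.

References (locators only): [SilvermanAEC2009] X.2 Prop. 2.4, X.5 Cor. 5.4 (iii)–(iv), VII.1 Rem. 1.1,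
VII.5 Prop. 5.1(a); [SilvermanATAEC1994] IV.9.4 Steps 4/6/9, Table 4.1; [Lang1987] Ch. 13 §4 Thm. 12.
-/

set_option autoImplicit false
set_option linter.dupNamespace false

noncomputable section

open scoped Classical NumberField

open WeierstrassCurve NumberField IsDedekindDomain IsDedekindDomain.HeightOneSpectrum Field
  Rat.HeightOneSpectrum
open Literature.NumberTheory.EllipticCurves
open Literature.NumberTheory.GaloisRepresentations
open Literature.NumberTheory.EllipticCurves.ModularForms
open Literature.NumberTheory.EllipticCurves.Rank1Residual
open Literature.NumberTheory.EllipticCurves.Rank1Residual.Typed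
open Literature.NumberTheory.Automorphic
open Literature.NumberTheory.DiophantineGeometry
open Literature.NumberTheory.DiophantineGeometry.TateAlgorithm
open Literature.NumberTheory.EllipticCurves.Rank1Residual.X11RankOneCertificates
open Summit.BirchSwinnertonDyer.Rank1Residual
open Summit.BirchSwinnertonDyer.Rank1Residual.X12
open Summit.BirchSwinnertonDyer.Rank1Residual.X12.O10
open Summit.BirchSwinnertonDyer.BirchSwinnertonDyer.Theses.InertBadSignedBranches
open Summit.BirchSwinnertonDyer.BirchSwinnertonDyer.Theorems.InertBadOffQuarticFamily
open Summit.BirchSwinnertonDyer.BirchSwinnertonDyer.Theorems.InertBadOffQuarticFamilyIff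

namespace Summit.BirchSwinnertonDyer.BirchSwinnertonDyer.Theorems.InertBadOffNoQuadraticTwin

/-! ## §1 Quadratic twists of the family `y² = x³ + a x` -/

/-- **`E_a^{(d)} = E_{d² a}` on the nose**: the tree's quadratic twist (`⟨0, d b₂/4, 0, d² b₄/2, d³ b₆/4⟩`)
of `y² = x³ + a x` (`b₂ = b₆ = 0`, `b₄ = 2a`) is `y² = x³ + d² a x`.
[cite: SilvermanAEC2009, X.2 Prop. 2.4 and X.5 Cor. 5.4 (iii)] -/
theorem quadraticTwist_quartic (a d : ℚ) :
    (⟨0, 0, 0, a, 0⟩ : WeierstrassCurve ℚ).quadraticTwist d = ⟨0, 0, 0, d ^ 2 * a, 0⟩ := by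
  ext <;> simp [WeierstrassCurve.quadraticTwist, WeierstrassCurve.b₂, WeierstrassCurve.b₄,
    WeierstrassCurve.b₆]
  ring

/-- **Twisting a curve of the family, in any model**: if `D • W = (y² = x³ + a x)` and `V` is ANY
`ℚ`-model of the twist, `C • W^{(d)} = V`, then `(⟨D.u, d·D.r, 0, 0⟩ * C⁻¹) • V = (y² = x³ + d² a x)`
(twisting commutes with changes of variables up to the explicit change `(u, d r, 0, 0)` — tree
`WeierstrassCurve.quadraticTwist_smul`). [cite: SilvermanAEC2009, X.2 Prop. 2.4 and X.5 Cor. 5.4 (iii)] -/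
theorem smul_quadraticTwist_eq_quartic (W V : WeierstrassCurve ℚ) (D C : VariableChange ℚ) {a d : ℚ}
    (hD : D • W = ⟨0, 0, 0, a, 0⟩) (hV : C • W.quadraticTwist d = V) :
    (⟨D.u, d * D.r, 0, 0⟩ * C⁻¹ : VariableChange ℚ) • V = ⟨0, 0, 0, d ^ 2 * a, 0⟩ := by
  rw [mul_smul, ← hV, inv_smul_smul, ← WeierstrassCurve.quadraticTwist_smul W D d, hD,
    quadraticTwist_quartic]

/-- For `d = 0` the "twist" `y² = x³` is singular, so no ELLIPTIC `V` is a model of it. [folklore] -/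
theorem ne_zero_of_smul_quadraticTwist (W V : WeierstrassCurve ℚ) [V.IsElliptic] (C : VariableChange ℚ)
    {d : ℚ} (hV : C • W.quadraticTwist d = V) : d ≠ 0 := by
  rintro rfl
  have h0 : (W.quadraticTwist 0).Δ = 0 := by
    rw [WeierstrassCurve.quadraticTwist_Δ]; ring
  have hΔ : V.Δ = 0 := by
    rw [← hV, variableChange_Δ, h0, mul_zero]
  exact V.isUnit_Δ.ne_zero hΔ

/-! ## §2 Membership with a rational coefficient, and `3`-adic rescaling into the window `ord₃ ∈ {1, 3}` -/

/-- **g3's membership theorem with a RATIONAL coefficient**: `D • W = (y² = x³ + a x)` with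
`ord₃ a = s ∈ {1, 2, 3}` (as a valuation at the place `v` over `3`) ⟹ `W` has signed local type
`(3, III)`, `(3, I₀*)`, `(3, III*)` respectively (`j = 1728` ⟹ CM by `ℤ[i]`, `3` inert; bad and the exact
Tate step from `InertBadOffQuarticFamily`). [cite: SilvermanATAEC1994, IV.9.4 and Table 4.1]
[cite: SilvermanAEC2009, X.5.4 (iii) and VII.5 Prop. 5.1(a)] -/
theorem hasSignedLocalType_three_of_smul_eq_quartic_of_valuation (W : WeierstrassCurve ℚ) [W.IsElliptic]
    [Fact (Nat.Prime 3)] (D : VariableChange ℚ) {a : ℚ} (hM : D • W = ⟨0, 0, 0, a, 0⟩)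
    (v : HeightOneSpectrum (𝓞 ℚ)) (hv : natGenerator v = 3) {s : ℕ} (hs1 : 1 ≤ s) (hs3 : s ≤ 3)
    (ha : v.valuation ℚ a = WithZero.exp (-(s : ℤ))) :
    HasSignedLocalType W 3
      (if s = 1 then KodairaSymbol.III else if s = 2 then KodairaSymbol.Istar 0 else KodairaSymbol.IIIstar) := by
  have hv2 : natGenerator v ≠ 2 := by rw [hv]; decide
  have hj : W.j = 1728 := j_eq_1728_of_smul_eq_quartic W D hM
  haveI : (D • W).IsElliptic := inferInstance
  refine (InertBadOffLowerHalf.hasSignedLocalType_three_iff W _ v hv).mpr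
    ⟨hasCM_of_j_eq_1728 W hj, cmInert_three_of_j_eq_1728 W hj, fun hg ↦ ?_, ?_⟩
  · have hgW : W.HasGoodReductionAt v := (good_iff_hasGoodReductionAt W 3 v hv).mp hg
    have hgM : (D • W).HasGoodReductionAt v := (hasGoodReductionAt_smul_iff_holds v W D).mpr hgW
    exact not_hasGoodReductionAt_of_eq_quartic (D • W) v hv2 hM hs1 hs3 ha hgM
  · exact kodairaSymbolAt_of_quartic_model_eq W v hv2 (D • W) D rfl hM hs1 hs3 ha

/-- The place over `3` gives `3` the valuation `exp (−1)`. [folklore] -/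
theorem valuation_three (v : HeightOneSpectrum (𝓞 ℚ)) (hv : natGenerator v = 3) :
    v.valuation ℚ (3 : ℚ) = WithZero.exp (-1 : ℤ) := by
  have h := valuation_ringOfIntegers_natCast_primesEquiv v
  have h3 : ((primesEquiv v : ℕ) : ℚ) = 3 := by rw [show (primesEquiv v : ℕ) = 3 from hv]; norm_num
  rwa [h3] at h

/-- **`3`-adic rescaling into the window.** For `a ∈ ℚˣ` whose `3`-adic order `m = −log v(a)` is ODD
there are `k ∈ ℤ` and `s ∈ {1, 3}`, `s ≡ m (mod 4)`, with `ord₃ (a / 3^{4k}) = s`; i.e. the scaling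
`(3ᵏ; 0, 0, 0)` carries `y² = x³ + a x` to `y² = x³ + a' x` with `ord₃ a' ∈ {1, 3}`
(`X12.smul_quartic_scale`). [cite: SilvermanAEC2009, X.5 Cor. 5.4 (iv) and VII.1 Rem. 1.1] -/
theorem exists_rescale_three (v : HeightOneSpectrum (𝓞 ℚ)) (hv : natGenerator v = 3) {a : ℚ}
    (ha : a ≠ 0) (hodd : Odd (WithZero.log (v.valuation ℚ a))) :
    ∃ (u : ℚˣ) (s : ℕ), (s = 1 ∨ s = 3) ∧ (s : ℤ) = (-WithZero.log (v.valuation ℚ a)) % 4 ∧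
      v.valuation ℚ (((u⁻¹ : ℚˣ) : ℚ) ^ 4 * a) = WithZero.exp (-(s : ℤ)) := by
  set ℓ : ℤ := WithZero.log (v.valuation ℚ a) with hℓ
  have hva : v.valuation ℚ a = WithZero.exp ℓ := (WithZero.exp_log ((Valuation.ne_zero_iff _).mpr ha)).symm
  -- `m = -ℓ = 4k + s`, `s ∈ {1, 3}`
  obtain ⟨t, ht⟩ := hodd
  set k : ℤ := (-ℓ) / 4 with hk
  have hs : (-ℓ) % 4 = 1 ∨ (-ℓ) % 4 = 3 := by omega
  have hks : -ℓ = 4 * k + (-ℓ) % 4 := by omega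
  have h3k : (3 : ℚ) ^ k ≠ 0 := zpow_ne_zero k (by norm_num)
  refine ⟨Units.mk0 ((3 : ℚ) ^ k) h3k, ((-ℓ) % 4).toNat, ?_, ?_, ?_⟩
  · rcases hs with h | h <;> simp [h]
  · exact Int.toNat_of_nonneg (by omega)
  · have hv3 := valuation_three v hv
    have hcoe : (((Units.mk0 ((3 : ℚ) ^ k) h3k)⁻¹ : ℚˣ) : ℚ) = ((3 : ℚ) ^ k)⁻¹ := by
      rw [Units.val_inv_eq_inv_val, Units.val_mk0]
    rw [hcoe, map_mul, map_pow, map_inv₀, map_zpow₀, hv3, hva, ← WithZero.exp_zsmul, ← WithZero.exp_neg,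
      ← WithZero.exp_nsmul, ← WithZero.exp_add]
    congr 1
    have : (((-ℓ) % 4).toNat : ℤ) = (-ℓ) % 4 := Int.toNat_of_nonneg (by omega)
    rw [this]
    simp only [smul_eq_mul, nsmul_eq_mul, Nat.cast_ofNat]
    omega

/-! ## §3 The corner is stable under every quadratic twist; no quadratic twist is good at `3` -/

/-- **ENGINE.** `W` of signed type `(3, T)`, `T = III` (`s₀ = 1`) or `III*` (`s₀ = 3`), `V` any elliptic
model of any quadratic twist `W^{(d)}` (`C • W^{(d)} = V`, hence `d ≠ 0`): `V` has signed type `(3, III)` if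
`s₀ − 2·log v(d) ≡ 1 (mod 4)` and `(3, III*)` otherwise (`≡ 3`). Proof: g3's integral quartic model
`D • W = (y² = x³ + A x)`, `ord₃ A = s₀`; §1 gives the model `y² = x³ + d² A x` of `V`; `ord₃ (d² A)` is odd;
rescale into the window and read the type (§2). [cite: SilvermanATAEC1994, IV.9.4 and Table 4.1]
[cite: SilvermanAEC2009, X.5 Cor. 5.4 (iii)–(iv)] -/
theorem hasSignedLocalType_three_of_smul_quadraticTwist_core (W : WeierstrassCurve ℚ) [W.IsElliptic]
    [Fact (Nat.Prime 3)] {T : KodairaSymbol} (hT : HasSignedLocalType W 3 T) (hT' : T = .III ∨ T = .IIIstar)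
    (v : HeightOneSpectrum (𝓞 ℚ)) (hv : natGenerator v = 3) {d : ℚ} (V : WeierstrassCurve ℚ) [V.IsElliptic]
    (C : VariableChange ℚ) (hV : C • W.quadraticTwist d = V) :
    ∃ s₀ : ℕ, ((T = .III ∧ s₀ = 1) ∨ (T = .IIIstar ∧ s₀ = 3)) ∧
      HasSignedLocalType V 3
        (if (-(2 * WithZero.log (v.valuation ℚ d) - s₀)) % 4 = 1 then .III else .IIIstar) := by
  have hd : d ≠ 0 := ne_zero_of_smul_quadraticTwist W V C hV
  obtain ⟨A, D, hM, hdiv⟩ := exists_smul_eq_quartic_of_hasSignedLocalType_three W hT hT'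
  obtain ⟨s₀, hTs, h1, h2⟩ : ∃ s₀ : ℕ, ((T = .III ∧ s₀ = 1) ∨ (T = .IIIstar ∧ s₀ = 3)) ∧
      (3 : ℤ) ^ s₀ ∣ A ∧ ¬ (3 : ℤ) ^ (s₀ + 1) ∣ A := by
    rcases hdiv with ⟨hT3, h3, h9⟩ | ⟨hT3, h27, h81⟩
    · exact ⟨1, Or.inl ⟨hT3, rfl⟩, by simpa using h3, by simpa using h9⟩
    · exact ⟨3, Or.inr ⟨hT3, rfl⟩, by simpa using h27, by simpa using h81⟩
  refine ⟨s₀, hTs, ?_⟩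
  have hA0 : (A : ℚ) ≠ 0 := by
    have : A ≠ 0 := by rintro rfl; exact h2 (dvd_zero _)
    exact_mod_cast this
  have hdA : d ^ 2 * (A : ℚ) ≠ 0 := mul_ne_zero (pow_ne_zero 2 hd) hA0
  have hvd0 : v.valuation ℚ d ≠ 0 := (Valuation.ne_zero_iff _).mpr hd
  have hvA : v.valuation ℚ (A : ℚ) = WithZero.exp (-(s₀ : ℤ)) := valuation_three_intCast_eq h1 h2 v hv
  -- `log v(d²A) = 2 log v(d) − s₀` is odd
  have hlog : WithZero.log (v.valuation ℚ (d ^ 2 * (A : ℚ))) = 2 * WithZero.log (v.valuation ℚ d) - s₀ := by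
    rw [map_mul, map_pow, WithZero.log_mul (pow_ne_zero 2 hvd0) ((Valuation.ne_zero_iff _).mpr hA0),
      WithZero.log_pow, hvA, WithZero.log_exp]
    simp only [nsmul_eq_mul, Nat.cast_ofNat]
    ring
  have hodd : Odd (WithZero.log (v.valuation ℚ (d ^ 2 * (A : ℚ)))) := by
    rw [hlog]
    rcases hTs with ⟨-, rfl⟩ | ⟨-, rfl⟩
    · exact ⟨WithZero.log (v.valuation ℚ d) - 1, by push_cast; ring⟩
    · exact ⟨WithZero.log (v.valuation ℚ d) - 2, by push_cast; ring⟩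
  -- the model `y² = x³ + d²A x` of `V`, rescaled into the window, read by the exact Tate step
  have hM' := smul_quadraticTwist_eq_quartic W V D C hM hV
  obtain ⟨u, s, hs13, hsmod, hval⟩ := exists_rescale_three v hv hdA hodd
  have hM'' : (⟨u, 0, 0, 0⟩ * (⟨D.u, d * D.r, 0, 0⟩ * C⁻¹) : VariableChange ℚ) • V =
      ⟨0, 0, 0, ((u⁻¹ : ℚˣ) : ℚ) ^ 4 * (d ^ 2 * (A : ℚ)), 0⟩ := by
    rw [mul_smul, hM', X12.smul_quartic_scale]
  have hTV := hasSignedLocalType_three_of_smul_eq_quartic_of_valuation V _ hM'' v hv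
    (s := s) (by omega) (by omega) hval
  rw [← hlog]
  rcases hs13 with rfl | rfl
  · rw [if_pos (by omega)]; simpa using hTV
  · rw [if_neg (by omega)]; simpa using hTV

/-- **The corner is stable under every quadratic twist.** `W` of signed local type `(3, III)` or
`(3, III*)`, `d ∈ ℚ`, `V` ANY elliptic `ℚ`-model with `C • W^{(d)} = V`: `V` has signed local type
`(3, III)` or `(3, III*)`. UNCONDITIONAL, any rank. [cite: SilvermanATAEC1994, IV.9.4 and Table 4.1]
[cite: SilvermanAEC2009, X.5 Cor. 5.4 (iii)–(iv)] -/
theorem hasSignedLocalType_three_of_smul_quadraticTwist (W : WeierstrassCurve ℚ) [W.IsElliptic]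
    [Fact (Nat.Prime 3)] {T : KodairaSymbol} (hT : HasSignedLocalType W 3 T)
    (hT' : T = .III ∨ T = .IIIstar) {d : ℚ} (V : WeierstrassCurve ℚ) [V.IsElliptic]
    (C : VariableChange ℚ) (hV : C • W.quadraticTwist d = V) :
    HasSignedLocalType V 3 .III ∨ HasSignedLocalType V 3 .IIIstar := by
  obtain ⟨v, hv⟩ := InertBadOffLowerHalf.exists_place_three
  obtain ⟨s₀, -, h⟩ := hasSignedLocalType_three_of_smul_quadraticTwist_core W hT hT' v hv V C hV
  split_ifs at h
  · exact Or.inl h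
  · exact Or.inr h

/-- **Even `ord₃ d` preserves the signed type** (`d` a `3`-adic unit times an even power of `3`, e.g.
`d = −1` or any `d` prime to `3`): type `(3, T)` ⟹ every elliptic model of `W^{(d)}` has type `(3, T)`,
`T ∈ {III, III*}`. [cite: SilvermanATAEC1994, IV.9.4 and Table 4.1] [cite: SilvermanAEC2009, X.5 Cor. 5.4 (iii)–(iv)] -/
theorem hasSignedLocalType_three_of_smul_quadraticTwist_of_even (W : WeierstrassCurve ℚ) [W.IsElliptic]
    [Fact (Nat.Prime 3)] {T : KodairaSymbol} (hT : HasSignedLocalType W 3 T)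
    (hT' : T = .III ∨ T = .IIIstar) (v : HeightOneSpectrum (𝓞 ℚ)) (hv : natGenerator v = 3)
    {d : ℚ} (heven : Even (WithZero.log (v.valuation ℚ d)))
    (V : WeierstrassCurve ℚ) [V.IsElliptic] (C : VariableChange ℚ) (hV : C • W.quadraticTwist d = V) :
    HasSignedLocalType V 3 T := by
  obtain ⟨s₀, hTs, h⟩ := hasSignedLocalType_three_of_smul_quadraticTwist_core W hT hT' v hv V C hV
  obtain ⟨j, hj⟩ := heven
  rcases hTs with ⟨rfl, rfl⟩ | ⟨rfl, rfl⟩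
  · rwa [if_pos (by rw [hj]; push_cast; omega)] at h
  · rwa [if_neg (by rw [hj]; push_cast; omega)] at h

/-- **Odd `ord₃ d` SWAPS the signed types `III ↔ III*`** (`d = ±3` times a unit square class, e.g. the
route's `p* = −3`): type `(3, III)` ⟹ every elliptic model of `W^{(d)}` has type `(3, III*)`, and vice
versa. [cite: SilvermanATAEC1994, IV.9.4 and Table 4.1] [cite: SilvermanAEC2009, X.5 Cor. 5.4 (iii)–(iv)] -/
theorem hasSignedLocalType_three_of_smul_quadraticTwist_of_odd (W : WeierstrassCurve ℚ) [W.IsElliptic]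
    [Fact (Nat.Prime 3)] {T : KodairaSymbol} (hT : HasSignedLocalType W 3 T)
    (hT' : T = .III ∨ T = .IIIstar) (v : HeightOneSpectrum (𝓞 ℚ)) (hv : natGenerator v = 3)
    {d : ℚ} (hdodd : Odd (WithZero.log (v.valuation ℚ d)))
    (V : WeierstrassCurve ℚ) [V.IsElliptic] (C : VariableChange ℚ) (hV : C • W.quadraticTwist d = V) :
    HasSignedLocalType V 3 (if T = .III then .IIIstar else .III) := by
  obtain ⟨s₀, hTs, h⟩ := hasSignedLocalType_three_of_smul_quadraticTwist_core W hT hT' v hv V C hV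
  obtain ⟨j, hj⟩ := hdodd
  rcases hTs with ⟨rfl, rfl⟩ | ⟨rfl, rfl⟩
  · rw [if_neg (by rw [hj]; push_cast; omega)] at h
    simpa using h
  · rw [if_pos (by rw [hj]; push_cast; omega)] at h
    simpa using h

/-- **The route's own twist `p* = (−1)^{(3/2)}·3 = −3` swaps the two halves of O10-SC@3**: type `(3, III)`
⟹ every model of `W^{(−3)}` has type `(3, III*)`, and `(3, III*)` ⟹ `(3, III)` (48 ↔ 49 census classes up
to the rank condition). [cite: SilvermanATAEC1994, IV.9.4 and Table 4.1] -/
theorem hasSignedLocalType_three_swap_of_smul_quadraticTwist_pStar (W : WeierstrassCurve ℚ) [W.IsElliptic]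
    [Fact (Nat.Prime 3)] {T : KodairaSymbol} (hT : HasSignedLocalType W 3 T)
    (hT' : T = .III ∨ T = .IIIstar) (V : WeierstrassCurve ℚ) [V.IsElliptic] (C : VariableChange ℚ)
    (hV : C • W.quadraticTwist ((-1) ^ (3 / 2) * 3) = V) :
    HasSignedLocalType V 3 (if T = .III then .IIIstar else .III) := by
  obtain ⟨v, hv⟩ := InertBadOffLowerHalf.exists_place_three
  refine hasSignedLocalType_three_of_smul_quadraticTwist_of_odd W hT hT' v hv ?_ V C hV
  have h : ((-1 : ℚ) ^ (3 / 2) * 3) = -3 := by norm_num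
  rw [h, Valuation.map_neg, valuation_three v hv, WithZero.log_exp]
  exact ⟨-1, by norm_num⟩

/-- **No quadratic twist of a corner curve is GOOD at `3`** — signed-type form: `W` of type `(3, III)` or
`(3, III*)`, `V` any elliptic model of any `W^{(d)}` ⟹ `¬ V.HasGoodReductionAtPrime 3`.
[cite: SilvermanATAEC1994, IV.9.4 and Table 4.1] [cite: SilvermanAEC2009, VII.5 Prop. 5.1(a)] -/
theorem not_hasGoodReductionAtPrime_three_of_smul_quadraticTwist (W : WeierstrassCurve ℚ) [W.IsElliptic]
    [Fact (Nat.Prime 3)] {T : KodairaSymbol} (hT : HasSignedLocalType W 3 T)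
    (hT' : T = .III ∨ T = .IIIstar) {d : ℚ} (V : WeierstrassCurve ℚ) [V.IsElliptic]
    (C : VariableChange ℚ) (hV : C • W.quadraticTwist d = V) : ¬ V.HasGoodReductionAtPrime 3 := by
  rcases hasSignedLocalType_three_of_smul_quadraticTwist W hT hT' V C hV with h | h
  · exact h.2.2.1
  · exact h.2.2.1

/-- **The item's four hypotheses pass to every quadratic twist** (19657's corner is closed under
quadratic twisting): `W` CM, `3` inert, bad at `3`, not of signed type `(3, I₀*)`, `C • W^{(d)} = V`
elliptic ⟹ the same four facts for `V`. UNCONDITIONAL, any rank. [cite: SilvermanATAEC1994, IV.9.4 and Table 4.1] -/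
theorem offIstarZero_of_smul_quadraticTwist (W : WeierstrassCurve ℚ) [W.IsElliptic] [Fact (Nat.Prime 3)]
    (hCM : W.HasCM) (hin : CMInert W 3) (hbad : ¬ Good W 3) (hoff : ¬ HasSignedLocalType W 3 (.Istar 0))
    {d : ℚ} (V : WeierstrassCurve ℚ) [V.IsElliptic] (C : VariableChange ℚ)
    (hV : C • W.quadraticTwist d = V) :
    V.HasCM ∧ CMInert V 3 ∧ ¬ Good V 3 ∧ ¬ HasSignedLocalType V 3 (.Istar 0) := by
  rcases (InertBadOffLowerHalf.j_eq_1728_and_hasSignedLocalType_of_offIstarZero W hCM hin hbad hoff).2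
    with hT | hT
  · rcases hasSignedLocalType_three_of_smul_quadraticTwist W hT (Or.inl rfl) V C hV with h | h
    · exact InertBadOffLowerHalf.offIstarZero_of_hasSignedLocalType_III V h
    · exact InertBadOffLowerHalf.offIstarZero_of_hasSignedLocalType_IIIstar V h
  · rcases hasSignedLocalType_three_of_smul_quadraticTwist W hT (Or.inr rfl) V C hV with h | h
    · exact InertBadOffLowerHalf.offIstarZero_of_hasSignedLocalType_III V h
    · exact InertBadOffLowerHalf.offIstarZero_of_hasSignedLocalType_IIIstar V h

/-! ## §4 The typed obstruction: the lever's `pairData` does not exist on the corner -/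

/-- **TYPED OBSTRUCTION (the item docstring's «no QUADRATIC twist with good reduction at 3 exists»,
kernel-checked).** For `W` on 19657's corner (CM, `3` inert, bad at `3`, not of signed type `(3, I₀*)`)
there is NO `d : ℚ`, NO elliptic `ℚ`-curve `V` and NO change of variables `C` with
`C • W.quadraticTwist d = V ∧ V.HasGoodReductionAtPrime 3` — the first output of the O10 lever
`X12.O10.pairData_elim` / `exists_goodTwist_pStar_of_hasSignedLocalType_IstarZero` (a good twin
`V = W^{(p*)}`) cannot be produced on this corner by ANY quadratic character, not only `p* = −3`. So no
O10-type consumer keyed to a good QUADRATIC twin reaches the corner; 19657 is not a missed case of the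
lever but outside its domain. Nothing asserted about BSD. [cite: SilvermanATAEC1994, IV.9.4 and Table 4.1]
[cite: SilvermanAEC2009, X.5 Cor. 5.4 (iii) and VII.5 Prop. 5.1(a)] -/
theorem not_exists_good_quadraticTwist_of_offIstarZero (W : WeierstrassCurve ℚ) [W.IsElliptic]
    [Fact (Nat.Prime 3)] (hCM : W.HasCM) (hin : CMInert W 3) (hbad : ¬ Good W 3)
    (hoff : ¬ HasSignedLocalType W 3 (.Istar 0)) :
    ¬ ∃ (d : ℚ) (V : WeierstrassCurve ℚ) (_ : V.IsElliptic) (C : VariableChange ℚ),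
      C • W.quadraticTwist d = V ∧ V.HasGoodReductionAtPrime 3 := by
  rintro ⟨d, V, _, C, hV, hgood⟩
  exact (offIstarZero_of_smul_quadraticTwist W hCM hin hbad hoff V C hV).2.2.1 hgood

/-- **The D71 split of `InertBadAtThree` IS the split «good quadratic twin exists / does not exist».**
On the inert-bad CM locus at `3` (`W` CM, `3` inert, bad at `3`): signed local type `(3, I₀*)` ⟺ some
quadratic twist of `W` has an elliptic `ℚ`-model with good reduction at `3`. (`⇒`: the sibling child's
supply `InertBadOdd.exists_goodTwist_pStar_of_hasSignedLocalType_IstarZero_of_ne_two`, `d = p* = −3`,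
Tate Step 6 read backwards; `⇐`: §4.) [cite: SilvermanATAEC1994, IV.9.4 Step 6 and Table 4.1] -/
theorem hasSignedLocalType_IstarZero_iff_exists_good_quadraticTwist (W : WeierstrassCurve ℚ) [W.IsElliptic]
    [Fact (Nat.Prime 3)] (hCM : W.HasCM) (hin : CMInert W 3) (hbad : ¬ Good W 3) :
    HasSignedLocalType W 3 (.Istar 0) ↔
      ∃ (d : ℚ) (V : WeierstrassCurve ℚ) (_ : V.IsElliptic) (C : VariableChange ℚ),
        C • W.quadraticTwist d = V ∧ V.HasGoodReductionAtPrime 3 := by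
  refine ⟨fun hT ↦ ?_, fun h ↦ ?_⟩
  · obtain ⟨V, hVe, -, C, hC, hgood, -⟩ :=
      InertBadOdd.exists_goodTwist_pStar_of_hasSignedLocalType_IstarZero_of_ne_two W hT (by decide)
    exact ⟨_, V, hVe, C, hC, hgood⟩
  · by_contra hoff
    exact not_exists_good_quadraticTwist_of_offIstarZero W hCM hin hbad hoff h

/-! ## §5 What DOES exist: the QUARTIC good twin `y² = x³ + a x`, `3 ∤ a` (CM inert, supersingular at `3`) -/

/-- **The corner curve and its quartic partner**: `W` on 19657's corner is `ℚ`-isomorphic to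
`y² = x³ + 3a x` (type `III`) or `y² = x³ + 27a x` (type `III*`) with `a ∈ ℤ`, `3 ∤ a` — the quartic
twists by `3`, `27` of `E_a : y² = x³ + a x` (isomorphic to `W` over `ℚ(∜3)`, `e = 4 = w_{ℚ(i)}` prime to
`3`). From g3's `exists_smul_eq_quartic_of_hasSignedLocalType_three`. [cite: SilvermanAEC2009, X.5.4 (iii) and Cor. 5.4 (iv)] -/
theorem exists_quartic_unit_model_of_offIstarZero (W : WeierstrassCurve ℚ) [W.IsElliptic]
    [Fact (Nat.Prime 3)] (hCM : W.HasCM) (hin : CMInert W 3) (hbad : ¬ Good W 3)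
    (hoff : ¬ HasSignedLocalType W 3 (.Istar 0)) :
    ∃ (a : ℤ) (D : VariableChange ℚ), ¬ (3 : ℤ) ∣ a ∧
      (D • W = ⟨0, 0, 0, ((3 * a : ℤ) : ℚ), 0⟩ ∨ D • W = ⟨0, 0, 0, ((27 * a : ℤ) : ℚ), 0⟩) := by
  rcases (InertBadOffLowerHalf.j_eq_1728_and_hasSignedLocalType_of_offIstarZero W hCM hin hbad hoff).2
    with hT | hT
  · obtain ⟨A, D, hM, hdiv⟩ := exists_smul_eq_quartic_of_hasSignedLocalType_three W hT (Or.inl rfl)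
    rcases hdiv with ⟨-, ⟨a, rfl⟩, h9⟩ | ⟨h, -⟩
    · refine ⟨a, D, fun ⟨b, hb⟩ ↦ h9 ⟨b, by rw [hb]; ring⟩, Or.inl hM⟩
    · exact absurd h (by decide)
  · obtain ⟨A, D, hM, hdiv⟩ := exists_smul_eq_quartic_of_hasSignedLocalType_three W hT (Or.inr rfl)
    rcases hdiv with ⟨h, -⟩ | ⟨-, ⟨a, rfl⟩, h81⟩
    · exact absurd h (by decide)
    · refine ⟨a, D, fun ⟨b, hb⟩ ↦ h81 ⟨b, by rw [hb]; ring⟩, Or.inr hM⟩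

/-- **The quartic partner is GOOD at `3`, CM by `ℤ[i]`, `3` inert**: every elliptic `V/ℚ` that is
`ℚ`-isomorphic to `y² = x³ + a x` with `a ∈ ℤ`, `3 ∤ a`. (Unit discriminant `−64a³` at `3`, g3's
`hasGoodReductionAt_of_eq_quartic_unit`; `j = 1728`.) [cite: SilvermanAEC2009, VII.5 Prop. 5.1(a) and X.5.4 (iii)] -/
theorem good_three_of_smul_eq_quartic_unit (V : WeierstrassCurve ℚ) [V.IsElliptic] [Fact (Nat.Prime 3)]
    (D : VariableChange ℚ) {a : ℤ} (h3 : ¬ (3 : ℤ) ∣ a) (hM : D • V = ⟨0, 0, 0, (a : ℚ), 0⟩) :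
    Good V 3 ∧ V.HasCM ∧ CMInert V 3 := by
  obtain ⟨v, hv⟩ := InertBadOffLowerHalf.exists_place_three
  have hv2 : natGenerator v ≠ 2 := by rw [hv]; decide
  haveI : (D • V).IsElliptic := inferInstance
  have hj : V.j = 1728 := j_eq_1728_of_smul_eq_quartic V D hM
  have hval : v.valuation ℚ ((a : ℤ) : ℚ) = 1 := Rat.valuation_intCast_eq_one v (by rw [hv]; exact_mod_cast h3)
  have hgood : (D • V).HasGoodReductionAt v := hasGoodReductionAt_of_eq_quartic_unit (D • V) v hv2 hM hval
  exact ⟨(good_iff_hasGoodReductionAt V 3 v hv).mpr ((hasGoodReductionAt_smul_iff_holds v V D).mp hgood),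
    hasCM_of_j_eq_1728 V hj, cmInert_three_of_j_eq_1728 V hj⟩

/-- **… and SUPERSINGULAR at `3`: `a₃(V) = 0`** for every globally minimal such `V` (Deuring at an inert good
prime, tree `frobeniusTrace_eq_zero_of_hasCM_of_cmInert`). This is the `e = 4` analogue of the twin datum
`V.frobeniusTrace p = 0` that `pairData_elim` feeds the signed theory on the type `I₀*` (`e = 2`).
[cite: Lang1987, Ch. 13 §4 Thm. 12 (PDF p. 140)] -/
theorem frobeniusTrace_three_eq_zero_of_smul_eq_quartic_unit (V : WeierstrassCurve ℚ) [V.IsElliptic]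
    [V.IsGloballyMinimal] [Fact (Nat.Prime 3)] (D : VariableChange ℚ) {a : ℤ} (h3 : ¬ (3 : ℤ) ∣ a)
    (hM : D • V = ⟨0, 0, 0, (a : ℚ), 0⟩) : V.frobeniusTrace 3 = 0 := by
  obtain ⟨hgood, hCM, hin⟩ := good_three_of_smul_eq_quartic_unit V D h3 hM
  exact frobeniusTrace_eq_zero_of_hasCM_of_cmInert hCM (by decide) hgood hin

end Summit.BirchSwinnertonDyer.BirchSwinnertonDyer.Theorems.InertBadOffNoQuadraticTwin

end
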